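import Mathlib
import Literature.Computability.AlgebraicComplexity.JointCircuits
import Literature.Computability.AlgebraicComplexity.FFTCircuitCost
import Literature.Computability.AlgebraicComplexity.SeriesExpODE
import Literature.Computability.AlgebraicComplexity.SeriesExpODECircuit
import HarnessLib

/-!
# Separable coefficient tensors by fast series arithmetic: `Σ_{|m| ≤ n} (∏_l c_l(m_l)) x^m` in `≈ 2n·2^J` gates

Topic `Computability/AlgebraicComplexity`, namespace `Literature.Computability.AlgebraicComplexity`.
Everything PROVED; bookkeeping definitions only (`gser`, `logDerCoeff`, `wser`, `sepProd`,
`sepTrunc`), no named facts.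

The truncated product `Φ = Σ_{d ≤ n} [s^d] ∏_l g_l(x_l s)` of `n` univariate power series
`g_l = Σ_k c_l(k) y^k` with `c_l(0) = 1` (FSV Construction 25's "separable" coefficient tensors
`coeff_m Φ = ∏_l c_l(m_l)`, `|m| ≤ n`; the dynamic programme of the tree's `…SeparableCoeffThree`
costs `n³`) is computed in `2 n 2^J + expCost J + n` gates for any `J` with `n + 1 ≤ 2^J` — i.e.
`≈ 4n² + O(n log² n)`: the product `y = ∏_l g_l(x_l s)` is THE solution of `y' = W y`, `y(0) = 1`,
with `W = Σ_l x_l · (g_l'/g_l)(x_l s)` (`derivativeFun_sepProd`), whose coefficients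
`[s^j] W = Σ_l μ_l(j) x_l^{j+1}` (`μ_l` = coefficients of `g_l' g_l^{-1}`) cost `n 2^J` products
(powers) and `n 2^J` weighted additions; then `jointlyComputed_expODE` (`SeriesExpODECircuit.lean`)
and a final sum:

* `jointlyComputed_powers`, `jointlyComputed_wser` — the coefficients of `W`;
* `derivativeFun_sepProd`, `coeff_zero_sepProd`, `mvcoeff_coeff_sepProd` — the ODE and the
  coefficients of `y`;
* `jointlyComputed_sepTrunc` — the circuit; `coeff_sepTrunc`, `totalDegree_sepTrunc_le`.

Tables with `c_l(0) ≠ 1` reduce to this by scaling; tables with `c_l(0) = 0` by factoring the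
monomial `∏_l x_l^{ord g_l}` (not done here).

## References

* R. P. Brent, J. ACM 23 (1976) §§5–6 (Newton for `exp`). [Brent1976]
* [ForbesShpilkaVolk2018] M. Forbes, A. Shpilka, B. L. Volk, *Succinct hitting sets and barriers to
  proving lower bounds for algebraic circuits*, Theory of Computing 14 (2018), Construction 25
  (separable coefficient vectors).
-/

noncomputable section

open MvPolynomial

namespace Literature.Computability.AlgebraicComplexity

section SeparableSeries

universe uu ww

variable {k : Type uu} [CommRing k]

open _root_.Finset _root_.PowerSeries

/-! ### The series -/

variable (n : ℕ) (c : Fin n → ℕ → k)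

/-- `G_l = g_l(x_l s) = Σ_j c_l(j) x_l^j s^j`. [cite: ForbesShpilkaVolk2018, Construction 25] -/
def gser (l : Fin n) : PowerSeries (MvPolynomial (Fin n) k) :=
  PowerSeries.mk fun j => MvPolynomial.C (c l j) * X l ^ j

/-- `μ_l` = the coefficients of the logarithmic derivative `g_l' · g_l^{-1}` in `k⟦y⟧`
(`g_l(0) = 1`). [cite: Brent1976, §5] -/
def logDerCoeff (l : Fin n) (j : ℕ) : k :=
  coeff j (derivativeFun (PowerSeries.mk (c l)) * (PowerSeries.mk (c l)).invOfUnit 1)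

/-- `W = Σ_l x_l · (g_l'/g_l)(x_l s)`: `[s^j] W = Σ_l μ_l(j) x_l^{j+1}`. [cite: Brent1976, §5] -/
def wser : PowerSeries (MvPolynomial (Fin n) k) :=
  PowerSeries.mk fun j => ∑ l, MvPolynomial.C (logDerCoeff n c l j) * X l ^ (j + 1)

/-- `y = ∏_l g_l(x_l s)`. [cite: ForbesShpilkaVolk2018, Construction 25] -/
def sepProd : PowerSeries (MvPolynomial (Fin n) k) := ∏ l, gser n c l

/-- The logarithmic-derivative identity in `k⟦y⟧`: `Σ_{a+b=j} μ_l(a) c_l(b) = (j+1) c_l(j+1)`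
(`(g_l' g_l^{-1}) g_l = g_l'`). [cite: Brent1976, §5] -/
theorem sum_logDerCoeff_mul (hc : ∀ l, c l 0 = 1) (l : Fin n) (j : ℕ) :
    ∑ ab ∈ antidiagonal j, logDerCoeff n c l ab.1 * c l ab.2 = c l (j + 1) * (j + 1) := by
  have hg : PowerSeries.constantCoeff (PowerSeries.mk (c l)) = ((1 : kˣ) : k) := by
    rw [Units.val_one, PowerSeries.constantCoeff_mk, hc]
  have h : derivativeFun (PowerSeries.mk (c l)) * (PowerSeries.mk (c l)).invOfUnit 1 *
      PowerSeries.mk (c l) = derivativeFun (PowerSeries.mk (c l)) := by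
    rw [mul_assoc, mul_comm ((PowerSeries.mk (c l)).invOfUnit 1), PowerSeries.mul_invOfUnit _ _ hg,
      mul_one]
  have h' := congrArg (coeff j) h
  rw [PowerSeries.coeff_mul, coeff_derivativeFun, PowerSeries.coeff_mk] at h'
  rw [← h']
  refine sum_congr rfl fun ab _ => ?_
  rw [PowerSeries.coeff_mk]
  rfl

/-- `G_l' = (x_l · (g_l'/g_l)(x_l s)) · G_l`. [cite: Brent1976, §5] -/
theorem derivativeFun_gser (hc : ∀ l, c l 0 = 1) (l : Fin n) :
    derivativeFun (gser n c l) =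
      PowerSeries.mk (fun j => MvPolynomial.C (logDerCoeff n c l j) * X l ^ (j + 1)) * gser n c l := by
  ext j
  rw [coeff_derivativeFun, PowerSeries.coeff_mul]
  simp only [gser, PowerSeries.coeff_mk]
  have hterm : ∀ ab ∈ antidiagonal j,
      MvPolynomial.C (logDerCoeff n c l ab.1) * X l ^ (ab.1 + 1) * (MvPolynomial.C (c l ab.2) * X l ^ ab.2) =
      MvPolynomial.C (logDerCoeff n c l ab.1 * c l ab.2) * (X l : MvPolynomial (Fin n) k) ^ (j + 1) := by
    intro ab hab
    rw [Finset.HasAntidiagonal.mem_antidiagonal] at hab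
    rw [← hab, MvPolynomial.C_mul]
    ring
  rw [sum_congr rfl hterm, ← sum_mul, ← map_sum (MvPolynomial.C), sum_logDerCoeff_mul n c hc, MvPolynomial.C_mul,
    show (MvPolynomial.C ((j : k) + 1) : MvPolynomial (Fin n) k) = (j : MvPolynomial (Fin n) k) + 1 by simp]
  ring

/-- Leibniz for finite products of power series. [folklore] -/
private theorem derivativeFun_finset_prod {S : Type*} [CommRing S] {ι : Type*} [DecidableEq ι]
    (f : ι → S⟦X⟧) (s : Finset ι) :
    derivativeFun (∏ i ∈ s, f i) = ∑ i ∈ s, (∏ i' ∈ s.erase i, f i') * derivativeFun (f i) := by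
  induction s using Finset.induction_on with
  | empty => rw [prod_empty, derivativeFun_one, sum_empty]
  | insert a s ha ih =>
    rw [prod_insert ha, derivativeFun_mul, smul_eq_mul, smul_eq_mul, ih, sum_insert ha,
      erase_insert ha, mul_sum, add_comm]
    congr 1
    refine sum_congr rfl fun i hi => ?_
    have hia : i ≠ a := fun h => ha (h ▸ hi)
    rw [erase_insert_of_ne hia.symm, prod_insert (fun h => ha (mem_of_mem_erase h)), mul_assoc]

/-- **The separable product solves `y' = W y`.** [cite: Brent1976, §5] -/
theorem derivativeFun_sepProd (hc : ∀ l, c l 0 = 1) :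
    derivativeFun (sepProd n c) = wser n c * sepProd n c := by
  classical
  rw [sepProd, derivativeFun_finset_prod]
  have hw : wser n c = ∑ l, PowerSeries.mk (fun j => MvPolynomial.C (logDerCoeff n c l j) * X l ^ (j + 1)) := by
    ext j
    rw [wser, PowerSeries.coeff_mk, map_sum]
    simp only [PowerSeries.coeff_mk]
  rw [hw, sum_mul]
  refine sum_congr rfl fun l _ => ?_
  rw [derivativeFun_gser n c hc l, mul_comm, mul_assoc, mul_comm (gser n c l),
    prod_erase_mul _ _ (mem_univ l)]

/-- `y(0) = 1`. [cite: ForbesShpilkaVolk2018, Construction 25] -/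
theorem coeff_zero_sepProd (hc : ∀ l, c l 0 = 1) : coeff 0 (sepProd n c) = 1 := by
  rw [PowerSeries.coeff_zero_eq_constantCoeff_apply, sepProd, map_prod]
  refine prod_eq_one fun l _ => ?_
  rw [gser, PowerSeries.constantCoeff_mk, hc, MvPolynomial.C_1, pow_zero, mul_one]

/-- The `x^μ`-coefficient of `[s^d] y`: `∏_l c_l(μ_l)` if `|μ| = d`, else `0`.
[cite: ForbesShpilkaVolk2018, Construction 25] -/
theorem mvcoeff_coeff_sepProd (d : ℕ) (μ : Fin n →₀ ℕ) :
    MvPolynomial.coeff μ (coeff d (sepProd n c)) =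
      if μ.degree = d then ∏ l, c l (μ l) else 0 := by
  classical
  have hmon : ∀ ν : Fin n →₀ ℕ,
      ∏ l, (MvPolynomial.C (c l (ν l)) * X l ^ (ν l) : MvPolynomial (Fin n) k) = monomial ν (∏ l, c l (ν l)) := by
    intro ν
    rw [prod_mul_distrib, ← map_prod, monomial_eq, Finsupp.prod_fintype _ _ (fun i => pow_zero _)]
  rw [sepProd, PowerSeries.coeff_prod, coeff_sum]
  simp only [gser, PowerSeries.coeff_mk, hmon, MvPolynomial.coeff_monomial]
  rw [sum_ite_eq']
  have hmem : μ ∈ (univ : Finset (Fin n)).finsuppAntidiag d ↔ μ.degree = d := by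
    rw [mem_finsuppAntidiag, Finsupp.degree_eq_sum]
    simp
  by_cases h : μ.degree = d
  · rw [if_pos (hmem.2 h), if_pos h]
  · rw [if_neg (fun h' => h (hmem.1 h')), if_neg h]

/-- **The separable truncation** `Φ = Σ_{d ≤ n} [s^d] y = Σ_{|m| ≤ n} (∏_l c_l(m_l)) x^m`.
[cite: ForbesShpilkaVolk2018, Construction 25] -/
def sepTrunc : MvPolynomial (Fin n) k := ∑ d ∈ range (n + 1), coeff d (sepProd n c)

/-- `coeff_μ Φ = ∏_l c_l(μ_l)` for `|μ| ≤ n`, else `0`. [cite: ForbesShpilkaVolk2018, Construction 25] -/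
theorem coeff_sepTrunc (μ : Fin n →₀ ℕ) :
    MvPolynomial.coeff μ (sepTrunc n c) = if μ.degree ≤ n then ∏ l, c l (μ l) else 0 := by
  rw [sepTrunc, coeff_sum]
  simp only [mvcoeff_coeff_sepProd]
  rw [sum_ite_eq]
  simp only [mem_range, Nat.lt_succ_iff]

/-- `Φ` has total degree `≤ n`. [cite: ForbesShpilkaVolk2018, Construction 25] -/
theorem totalDegree_sepTrunc_le : (sepTrunc n c).totalDegree ≤ n := by
  rw [totalDegree]
  refine Finset.sup_le fun μ hμ => ?_
  rw [mem_support_iff, coeff_sepTrunc] at hμ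
  by_cases h : μ.degree ≤ n
  · have : (μ.sum fun _ e => e) = μ.degree := rfl
    rw [this]; exact h
  · exact absurd (if_neg h) hμ

/-! ### The circuit -/

/-- **Powers**: `x_l^{j+1}` for all `l < n`, `j < T`, in `n · T` gates on top of a family containing
the variables. [cite: Burgisser2000, Def. 2.1] -/
theorem jointlyComputed_powers {ι : Type ww} {v : ι → MvPolynomial (Fin n) k} {s : ℕ}
    (hv : JointlyComputed v s) (ex : Fin n → ι) (hex : ∀ l, v (ex l) = X l) :
    ∀ T : ℕ, JointlyComputed (Sum.elim v (fun p : Fin n × Fin T => (X p.1 : MvPolynomial (Fin n) k) ^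
      ((p.2 : ℕ) + 1))) (s + n * T)
  | 0 => by
    rw [Nat.mul_zero, Nat.add_zero]
    exact hv.of_mem _ (by rintro (x | ⟨l, j⟩); exacts [Or.inl ⟨x, rfl⟩, j.elim0])
  | T + 1 => by
    have ih := jointlyComputed_powers hv ex hex T
    -- one more power for every variable: `x_l^{T+1} = x_l^T · x_l`
    let w : (ι ⊕ (Fin n × Fin T)) ⊕ Fin n → MvPolynomial (Fin n) k :=
      Sum.elim (Sum.elim v (fun p : Fin n × Fin T => (X p.1 : MvPolynomial (Fin n) k) ^
        ((p.2 : ℕ) + 1))) (fun l => X l ^ T)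
    have hw : JointlyComputed w (s + n * T) := by
      refine ih.of_mem _ ?_
      rintro (x | l)
      · exact Or.inl ⟨x, rfl⟩
      · rcases Nat.eq_zero_or_pos T with hT | hT
        · exact Or.inr (Or.inr ⟨1, by simp [w, hT]⟩)
        · exact Or.inl ⟨Sum.inr (l, ⟨T - 1, by omega⟩), by
            simp [w, Nat.sub_add_cancel hT]⟩
    have h1 := hw.extend_mul (κ := Fin n) (fun l => Sum.inr l) (fun l => Sum.inl (Sum.inl (ex l)))
    rw [Fintype.card_fin, show s + n * T + n = s + n * (T + 1) by ring] at h1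
    refine h1.of_mem _ ?_
    rintro (x | ⟨l, j⟩)
    · exact Or.inl ⟨Sum.inl (Sum.inl (Sum.inl x)), rfl⟩
    · by_cases hj : (j : ℕ) < T
      · exact Or.inl ⟨Sum.inl (Sum.inl (Sum.inr (l, ⟨j, hj⟩))), rfl⟩
      · have hjT : (j : ℕ) = T := by have := j.isLt; omega
        refine Or.inl ⟨Sum.inr l, ?_⟩
        simp [w, hex, hjT, pow_succ]

/-- **The coefficients of `W`**: `[s^j] W = Σ_l μ_l(j) x_l^{j+1}` for `j < T`, in `n · T` weighted
additions on top of the powers. [cite: Brent1976, §5] -/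
theorem jointlyComputed_wser {ι : Type ww} {v : ι → MvPolynomial (Fin n) k} {s : ℕ} (T : ℕ)
    (hv : JointlyComputed v s) (ep : Fin n × Fin T → ι)
    (hep : ∀ p, v (ep p) = (X p.1 : MvPolynomial (Fin n) k) ^ ((p.2 : ℕ) + 1)) :
    ∀ m : ℕ, m ≤ n → JointlyComputed (Sum.elim v (fun j : Fin T =>
      ∑ l ∈ (univ : Finset (Fin n)).filter (fun l : Fin n => l.val < m),
        MvPolynomial.C (logDerCoeff n c l j) * X l ^ ((j : ℕ) + 1))) (s + m * T)
  | 0, _ => by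
    rw [Nat.zero_mul, Nat.add_zero]
    refine hv.of_mem _ ?_
    rintro (x | j)
    · exact Or.inl ⟨x, rfl⟩
    · refine Or.inr (Or.inr ⟨0, ?_⟩)
      simp
  | m + 1, hm => by
    have ih := jointlyComputed_wser T hv ep hep m (by omega)
    have h1 := ih.extend_wadd (κ := Fin T) (fun _ => (1 : k)) (fun j => logDerCoeff n c ⟨m, hm⟩ j)
      (fun j => Sum.inr j) (fun j => Sum.inl (ep (⟨m, hm⟩, j)))
    rw [Fintype.card_fin, show s + m * T + T = s + (m + 1) * T by ring] at h1
    refine h1.of_mem _ ?_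
    rintro (x | j)
    · exact Or.inl ⟨Sum.inl (Sum.inl x), rfl⟩
    · refine Or.inl ⟨Sum.inr j, ?_⟩
      simp only [Sum.elim_inr, Sum.elim_inl, one_smul, hep]
      have hsplit : (univ : Finset (Fin n)).filter (fun l : Fin n => l.val < m + 1) =
          insert ⟨m, hm⟩ ((univ : Finset (Fin n)).filter (fun l : Fin n => l.val < m)) := by
        ext l
        simp only [mem_filter, mem_univ, true_and, mem_insert, Fin.ext_iff]
        omega
      have hnot : (⟨m, hm⟩ : Fin n) ∉ (univ : Finset (Fin n)).filter (fun l : Fin n => l.val < m) := by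
        simp
      rw [hsplit, sum_insert hnot, MvPolynomial.smul_eq_C_mul, add_comm]

/-- **Separable coefficient tensors by fast series arithmetic** (FSV Construction 25, realised via
the exponential ODE): for univariate tables with `c_l(0) = 1`, the polynomial
`Φ = Σ_{|m| ≤ n} (∏_l c_l(m_l)) x^m` (`coeff_sepTrunc`) satisfies
`complexity Φ ≤ 2 n 2^J + expCost J + n` for every `J` with `n + 1 ≤ 2^J` (so `≈ 4n² + O(n log² n)`
with `2^J < 2n + 2`), given the roots of unity `ζ`, the inverses `tinv` of `2^κ` and `ninv j` of
`j + 1`. [cite: ForbesShpilkaVolk2018, Construction 25] -/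
theorem complexity_sepTrunc_le (ζ tinv : ℕ → k)
    (hζ : ∀ κ, κ ≠ 0 → ζ κ ^ 2 ^ (κ - 1) = -1) (ht : ∀ κ, (2 ^ κ : k) * tinv κ = 1)
    (ninv : ℕ → k) (hninv : ∀ j : ℕ, ((j : k) + 1) * ninv j = 1)
    (hc : ∀ l, c l 0 = 1) (J : ℕ) (hJ : n + 1 ≤ 2 ^ J) :
    complexity (sepTrunc n c) ≤ 2 * n * 2 ^ J + expCost J + n := by
  classical
  -- inputs
  let u : Fin n → MvPolynomial (Fin n) k := fun l => X l
  have hu : JointlyComputed u 0 := jointlyComputed_of_inputs u (fun l => Or.inl ⟨l, rfl⟩)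
  -- powers and the coefficients of `W`
  have h1 := jointlyComputed_powers n hu (fun l => l) (fun l => rfl) (2 ^ J)
  have h2 := jointlyComputed_wser n c (2 ^ J) h1 (fun p => Sum.inr p) (fun p => rfl) n le_rfl
  have hW : ∀ j : Fin (2 ^ J), (∑ l ∈ (univ : Finset (Fin n)).filter (fun l : Fin n => l.val < n),
      MvPolynomial.C (logDerCoeff n c l j) * X l ^ ((j : ℕ) + 1)) = coeff j (wser n c) := by
    intro j
    rw [wser, PowerSeries.coeff_mk, filter_true_of_mem (fun l _ => l.isLt)]
  -- the exponential ODE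
  have h3 := jointlyComputed_expODE ζ tinv hζ ht ninv hninv (wser n c) (sepProd n c)
    (derivativeFun_sepProd n c hc) (coeff_zero_sepProd n c hc) J _ _ (fun j => Sum.inr j) h2
    (fun j => by rw [Sum.elim_inr, hW])
  -- the final sum
  have h4 := jointlyComputed_sum h3 (fun d => coeff d (sepProd n c)) n
    (fun d => Sum.inr ⟨d, by omega⟩) (fun d => rfl)
  have := h4.complexity_le (Sum.inr ())
  have hcost : 0 + n * 2 ^ J + n * 2 ^ J + expCost J + n = 2 * n * 2 ^ J + expCost J + n := by ring
  rw [hcost] at this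
  simpa [sepTrunc] using this

end SeparableSeries

end Literature.Computability.AlgebraicComplexity

end
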